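import Summits.QuantumFields.QCD.Theorems.HeatSlicedQuarksQuarkLoopCoefficientFreeMajorantToolkitAuxD
import Summits.QuantumFields.QCD.Theorems.HeatSlicedQuarksQuarkLoopCoefficientFreeMajorantToolkitAuxE

/-!
# Quark-loop coefficient, stub `freeMajorantToolkit`, part F: the free Gaussian bound

Conjunct (1) of the free majorant toolkit of the line `Sketch` of the crux `QuarkLoopCoefficient`:
the free Wilson heat kernel on `ℤ⁴`,
`k_t(w) = (2π)⁻⁴ ∫_{[−π,π]⁴} e^{−t h(p)} cos(p·w) dp` (`freeKer`), obeys the two-regime Gaussian bound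

  `|k_t(w)| ≤ C (1+t)⁻² exp(−|w|²/(56 (1 + t + |w|))) = C Γ_{1/56}(t, w)`   (`t ≥ 0`, `w ∈ ℤ⁴`).

Proof: `k_t(w) = (2π)⁻⁴ Re ∫ Φ(p) dp` with `Φ(ζ) = exp(−tH(ζ) + iζ·w)`; by the contour shift of
part E, `∫ Φ(p) dp = ∫ Φ(p + iη) dp` for every `η ∈ ℝ⁴`; by part D,
`|Φ(p + iη)| ≤ e^{14t|η|² − η·w} e^{−t h(p)/2}` for `|η|_∞ ≤ 1`, and
`∫_{[−π,π]⁴} e^{−t h(p)/2} dp ≤ (π⁶ + 64π⁴)/(1+t)²` (zone lower bound `h ≥ (4/π²)|p|²`, product of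
one-dimensional Gaussian integrals for `t ≥ 1`, the volume `(2π)⁴` for `t ≤ 1`).  Finally
`η = w/|w|` if `|w| ≥ 28t` and `η = w/(28t)` otherwise give the exponent `−|w|/2`, resp.
`−|w|²/(56t)`, both `≤ −|w|²/(56(1+t+|w|))`.
-/

namespace Summit.QuantumFields.QCD.Cruxes.QuarkLoopCoefficient.Sketch.FreeMajorantToolkit

open Summit.QuantumFields.QCD.Theorems.QuarkLoopCoefficient
open Literature.MathematicalPhysics.QuantumLattice Literature.MathematicalPhysics.QuantumFieldTheory
open Literature.Probability.LatticeModels (Site TorusSite)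
open scoped Matrix ComplexConjugate
open MeasureTheory

/-- The Brillouin zone is the order interval `[−π, π]⁴` of `ℝ⁴`. -/
theorem brillouin_eq_Icc : brillouin = Set.Icc (fun _ : Fin 4 => -Real.pi) (fun _ => Real.pi) :=
  Set.pi_univ_Icc _ _

/-- The Gaussian box integral: `∫_{[−π,π]⁴} e^{−t h(p)/2} dp ≤ (π⁶ + 64π⁴)/(1+t)²` for `t ≥ 0`. -/
theorem setIntegral_exp_neg_half_hsymb_le {t : ℝ} (ht : 0 ≤ t) :
    ∫ p in brillouin, Real.exp (-(t * (hsymb p / 2))) ≤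
      (Real.pi ^ 6 + 64 * Real.pi ^ 4) / (1 + t) ^ 2 := by
  have hπ := Real.pi_pos
  have hle : (fun _ : Fin 4 => -Real.pi) ≤ (fun _ => Real.pi) := fun _ => by simp; linarith
  have hvol : (volume brillouin).toReal = (2 * Real.pi) ^ 4 := by
    rw [brillouin_eq_Icc, Real.volume_Icc_pi_toReal hle]
    simp
    ring
  have hnn : ∀ p, 0 ≤ Real.exp (-(t * (hsymb p / 2))) := fun p => (Real.exp_pos _).le
  -- bound 1: by the volume of the zone
  have hb1 : ∫ p in brillouin, Real.exp (-(t * (hsymb p / 2))) ≤ (2 * Real.pi) ^ 4 := by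
    have h := norm_setIntegral_le_of_norm_le_const (μ := volume) (s := brillouin) (C := 1)
      (f := fun p => Real.exp (-(t * (hsymb p / 2))))
      (by rw [brillouin_eq_Icc]; exact measure_Icc_lt_top) (fun p _ => by
        rw [Real.norm_eq_abs, abs_of_nonneg (hnn p), Real.exp_le_one_iff, neg_nonpos]
        have : 0 ≤ hsymb p := by unfold hsymb; positivity
        positivity)
    rw [measureReal_def, hvol, one_mul, Real.norm_eq_abs] at h
    exact (le_abs_self _).trans h
  -- bound 2: by the Gaussian integral over `ℝ⁴`, for `t > 0`
  have hb2 : 0 < t → ∫ p in brillouin, Real.exp (-(t * (hsymb p / 2))) ≤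
      Real.pi ^ 6 / (4 * t ^ 2) := by
    intro ht0
    set β := 2 * t / Real.pi ^ 2 with hβ
    have hβ0 : 0 < β := by positivity
    have hGi : Integrable (fun p : Fin 4 → ℝ => ∏ μ, Real.exp (-β * p μ ^ 2)) :=
      Integrable.fintype_prod (fun _ => integrable_exp_neg_mul_sq hβ0)
    have hmono : ∫ p in brillouin, Real.exp (-(t * (hsymb p / 2))) ≤
        ∫ p in brillouin, ∏ μ, Real.exp (-β * p μ ^ 2) := by
      refine setIntegral_mono_on ?_ hGi.integrableOn
        (by rw [brillouin_eq_Icc]; exact measurableSet_Icc) (fun p hp => ?_)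
      · refine ContinuousOn.integrableOn_compact (by rw [brillouin_eq_Icc]; exact isCompact_Icc)
          (Continuous.continuousOn ?_)
        unfold hsymb
        fun_prop
      · have hp' : ∀ μ, |p μ| ≤ Real.pi := fun μ => abs_le.2 (hp μ (Set.mem_univ μ))
        have h := exp_neg_half_hsymb_le_prod ht hp'
        refine h.trans (le_of_eq (Finset.prod_congr rfl fun μ _ => ?_))
        rw [hβ, neg_mul]
    have hwhole : ∫ p in brillouin, ∏ μ, Real.exp (-β * p μ ^ 2) ≤
        ∫ p : Fin 4 → ℝ, ∏ μ, Real.exp (-β * p μ ^ 2) :=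
      setIntegral_le_integral hGi (ae_of_all _ fun p =>
        Finset.prod_nonneg fun μ _ => (Real.exp_pos _).le)
    have hgauss : ∫ p : Fin 4 → ℝ, ∏ μ, Real.exp (-β * p μ ^ 2) = (Real.pi / β) ^ 2 := by
      rw [integral_fintype_prod_volume_eq_pow (fun x => Real.exp (-β * x ^ 2)), integral_gaussian,
        Fintype.card_fin, show (4 : ℕ) = 2 * 2 from rfl, pow_mul, Real.sq_sqrt (by positivity)]
    have hval : (Real.pi / β) ^ 2 = Real.pi ^ 6 / (4 * t ^ 2) := by
      rw [hβ]
      field_simp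
      ring
    linarith
  rcases le_or_gt t 1 with ht1 | ht1
  · rw [le_div_iff₀ (by positivity)]
    calc (∫ p in brillouin, Real.exp (-(t * (hsymb p / 2)))) * (1 + t) ^ 2
        ≤ (2 * Real.pi) ^ 4 * (1 + t) ^ 2 := by gcongr
      _ ≤ (2 * Real.pi) ^ 4 * 4 := by gcongr; nlinarith
      _ = 64 * Real.pi ^ 4 := by ring
      _ ≤ Real.pi ^ 6 + 64 * Real.pi ^ 4 := by nlinarith [pow_pos hπ 6]
  · have h2 := hb2 (by linarith)
    rw [le_div_iff₀ (by positivity)]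
    have ht2 : 0 < t ^ 2 := by positivity
    calc (∫ p in brillouin, Real.exp (-(t * (hsymb p / 2)))) * (1 + t) ^ 2
        ≤ Real.pi ^ 6 / (4 * t ^ 2) * (1 + t) ^ 2 := by gcongr
      _ ≤ Real.pi ^ 6 / (4 * t ^ 2) * (4 * t ^ 2) := by gcongr; nlinarith
      _ = Real.pi ^ 6 := by field_simp
      _ ≤ Real.pi ^ 6 + 64 * Real.pi ^ 4 := by nlinarith [pow_pos hπ 4]

/-- The shifted bound: for every `η ∈ ℝ⁴` with `|η|_∞ ≤ 1`,
`|k_t(w)| ≤ (2π)⁻⁴ (π⁶ + 64π⁴) (1+t)⁻² e^{14t|η|² − η·w}`. -/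
theorem abs_freeKer_le_of_shift {t : ℝ} (ht : 0 ≤ t) (w : Site 4) (η : Fin 4 → ℝ)
    (hη : ∀ μ, |η μ| ≤ 1) :
    |freeKer t w| ≤ ((2 * Real.pi)⁻¹) ^ 4 * ((Real.pi ^ 6 + 64 * Real.pi ^ 4) / (1 + t) ^ 2) *
      Real.exp (14 * t * ∑ μ, η μ ^ 2 - ∑ μ, η μ * ((w μ : ℤ) : ℝ)) := by
  set Φ₁ : (Fin 4 → ℝ) → ℂ := fun x => Complex.exp (-(t : ℂ) *
    ((∑ μ, Complex.sin ((x μ : ℂ) + (η μ : ℂ) * Complex.I) ^ 2) +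
      (∑ μ, (1 - Complex.cos ((x μ : ℂ) + (η μ : ℂ) * Complex.I))) ^ 2) +
      Complex.I * ∑ μ, ((x μ : ℂ) + (η μ : ℂ) * Complex.I) * ((w μ : ℤ) : ℂ)) with hΦ₁
  set Φ₀ : (Fin 4 → ℝ) → ℂ := fun x => Complex.exp (-(t : ℂ) *
    ((∑ μ, Complex.sin (x μ : ℂ) ^ 2) + (∑ μ, (1 - Complex.cos (x μ : ℂ))) ^ 2) +
      Complex.I * ∑ μ, (x μ : ℂ) * ((w μ : ℤ) : ℂ)) with hΦ₀
  set A := 14 * t * ∑ μ, η μ ^ 2 - ∑ μ, η μ * ((w μ : ℤ) : ℝ) with hA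
  have hshift : ∫ x in brillouin, Φ₁ x = ∫ x in brillouin, Φ₀ x := by
    rw [brillouin_eq_Icc]
    exact setIntegral_cexp_symbol_shift t w η
  have hre : ∀ x, (Φ₀ x).re = Real.exp (-(t * hsymb x)) * Real.cos (∑ μ, x μ * ((w μ : ℤ) : ℝ)) := by
    intro x
    have e : -(t : ℂ) * ((∑ μ, Complex.sin (x μ : ℂ) ^ 2) + (∑ μ, (1 - Complex.cos (x μ : ℂ))) ^ 2) +
        Complex.I * ∑ μ, (x μ : ℂ) * ((w μ : ℤ) : ℂ) =
        ((-(t * hsymb x) : ℝ) : ℂ) + ((∑ μ, x μ * ((w μ : ℤ) : ℝ) : ℝ) : ℂ) * Complex.I := by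
      unfold hsymb
      push_cast
      ring
    simp only [hΦ₀]
    rw [e, Complex.exp_re]
    simp
  have hK : IsCompact brillouin := by rw [brillouin_eq_Icc]; exact isCompact_Icc
  have hmeas : MeasurableSet brillouin := by rw [brillouin_eq_Icc]; exact measurableSet_Icc
  have hΦ₀c : Continuous Φ₀ := by rw [hΦ₀]; fun_prop
  have hΦ₁c : Continuous Φ₁ := by rw [hΦ₁]; fun_prop
  have hΦ₀i : IntegrableOn Φ₀ brillouin := hΦ₀c.continuousOn.integrableOn_compact hK
  have hΦ₁i : IntegrableOn Φ₁ brillouin := hΦ₁c.continuousOn.integrableOn_compact hK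
  have hk : freeKer t w = ((2 * Real.pi)⁻¹) ^ 4 * (∫ x in brillouin, Φ₀ x).re := by
    unfold freeKer
    congr 1
    rw [show (∫ x in brillouin, Φ₀ x).re = Complex.reCLM (∫ x in brillouin, Φ₀ x) from rfl,
      ← ContinuousLinearMap.integral_comp_comm _ hΦ₀i]
    exact integral_congr_ae (ae_of_all _ fun x => by simp only [Complex.reCLM_apply, hre])
  have hAx : ∀ x, ‖Φ₁ x‖ ≤ Real.exp A * Real.exp (-(t * (hsymb x / 2))) := by
    intro x
    have h := norm_shifted_integrand_le ht w x η (fun μ => (x μ : ℂ) + (η μ : ℂ) * Complex.I)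
      (fun μ => rfl) hη
    simp only [hΦ₁]
    refine h.trans (le_of_eq ?_)
    rw [← Real.exp_add, ← Real.exp_add, hA]
    ring_nf
  have hGi : IntegrableOn (fun x => Real.exp A * Real.exp (-(t * (hsymb x / 2)))) brillouin := by
    refine ContinuousOn.integrableOn_compact hK (Continuous.continuousOn ?_)
    unfold hsymb
    fun_prop
  calc |freeKer t w| = ((2 * Real.pi)⁻¹) ^ 4 * |(∫ x in brillouin, Φ₀ x).re| := by
        rw [hk, abs_mul, abs_of_nonneg (by positivity)]
    _ ≤ ((2 * Real.pi)⁻¹) ^ 4 * ‖∫ x in brillouin, Φ₀ x‖ := by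
        gcongr; exact Complex.abs_re_le_norm _
    _ = ((2 * Real.pi)⁻¹) ^ 4 * ‖∫ x in brillouin, Φ₁ x‖ := by rw [hshift]
    _ ≤ ((2 * Real.pi)⁻¹) ^ 4 * ∫ x in brillouin, ‖Φ₁ x‖ := by
        gcongr; exact norm_integral_le_integral_norm _
    _ ≤ ((2 * Real.pi)⁻¹) ^ 4 * ∫ x in brillouin, Real.exp A * Real.exp (-(t * (hsymb x / 2))) :=
        mul_le_mul_of_nonneg_left (setIntegral_mono_on hΦ₁i.norm hGi hmeas (fun x _ => hAx x))
          (by positivity)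
    _ = ((2 * Real.pi)⁻¹) ^ 4 * (Real.exp A * ∫ x in brillouin, Real.exp (-(t * (hsymb x / 2)))) := by
        rw [integral_const_mul]
    _ ≤ ((2 * Real.pi)⁻¹) ^ 4 * (Real.exp A * ((Real.pi ^ 6 + 64 * Real.pi ^ 4) / (1 + t) ^ 2)) := by
        gcongr; exact setIntegral_exp_neg_half_hsymb_le ht
    _ = _ := by ring

/-- Conjunct (1), quantitative: the free Gaussian bound
`|k_t(w)| ≤ (2π)⁻⁴ (π⁶ + 64π⁴) Γ_{1/56}(t, w)` for `t ≥ 0`, `w ∈ ℤ⁴`. -/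
theorem abs_freeKer_le_gaussProfile {t : ℝ} (ht : 0 ≤ t) (w : Site 4) :
    |freeKer t w| ≤ (((2 * Real.pi)⁻¹) ^ 4 * (Real.pi ^ 6 + 64 * Real.pi ^ 4)) *
      gaussProfile (1 / 56) t w := by
  have hR0 : 0 ≤ elen w := elen_nonneg w
  have htarget : ∀ A : ℝ, A ≤ -(1 / 56 * elen w ^ 2 / (1 + t + elen w)) →
      ((2 * Real.pi)⁻¹) ^ 4 * ((Real.pi ^ 6 + 64 * Real.pi ^ 4) / (1 + t) ^ 2) * Real.exp A ≤
        (((2 * Real.pi)⁻¹) ^ 4 * (Real.pi ^ 6 + 64 * Real.pi ^ 4)) * gaussProfile (1 / 56) t w := by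
    intro A hA
    unfold gaussProfile
    calc ((2 * Real.pi)⁻¹) ^ 4 * ((Real.pi ^ 6 + 64 * Real.pi ^ 4) / (1 + t) ^ 2) * Real.exp A
        ≤ ((2 * Real.pi)⁻¹) ^ 4 * ((Real.pi ^ 6 + 64 * Real.pi ^ 4) / (1 + t) ^ 2) *
          Real.exp (-(1 / 56 * elen w ^ 2 / (1 + t + elen w))) := by gcongr
      _ = _ := by rw [div_eq_mul_inv]; ring
  by_cases hw : w = 0
  · have h := abs_freeKer_le_of_shift ht w (fun _ => 0) (fun μ => by simp)
    refine h.trans (htarget _ (le_of_eq ?_))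
    subst hw
    simp [elen_zero]
  · have hR : 0 < elen w := lt_of_lt_of_le one_pos (one_le_elen hw)
    have hsq := elen_sq w
    rcases le_or_gt (28 * t) (elen w) with h28 | h28
    · -- Poisson regime: `η = w/|w|`
      have hη1 : ∀ μ, |((w μ : ℤ) : ℝ) / elen w| ≤ 1 := fun μ => by
        rw [abs_div, abs_of_pos hR, div_le_one hR]
        exact abs_apply_le_elen w μ
      have hs1 : ∑ μ, (((w μ : ℤ) : ℝ) / elen w) ^ 2 = 1 := by
        simp only [div_pow]
        rw [← Finset.sum_div, ← hsq, div_self (by positivity)]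
      have hs2 : ∑ μ, ((w μ : ℤ) : ℝ) / elen w * ((w μ : ℤ) : ℝ) = elen w := by
        have e : ∑ μ, ((w μ : ℤ) : ℝ) / elen w * ((w μ : ℤ) : ℝ) =
            (∑ μ, ((w μ : ℤ) : ℝ) ^ 2) / elen w := by
          rw [Finset.sum_div]
          exact Finset.sum_congr rfl fun μ _ => by ring
        rw [e, ← hsq]
        field_simp
      have h := abs_freeKer_le_of_shift ht w (fun μ => ((w μ : ℤ) : ℝ) / elen w) hη1
      rw [hs1, hs2] at h
      refine h.trans (htarget _ ?_)
      have h1 : elen w ^ 2 / (1 + t + elen w) ≤ elen w := by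
        rw [div_le_iff₀ (by linarith)]
        nlinarith
      have e : 1 / 56 * elen w ^ 2 / (1 + t + elen w) = 1 / 56 * (elen w ^ 2 / (1 + t + elen w)) := by
        ring
      rw [e]
      linarith
    · -- Gaussian regime: `η = w/(28t)`
      have ht0 : 0 < t := by nlinarith
      have hη1 : ∀ μ, |((w μ : ℤ) : ℝ) / (28 * t)| ≤ 1 := fun μ => by
        rw [abs_div, abs_of_pos (show (0 : ℝ) < 28 * t by positivity),
          div_le_one (show (0 : ℝ) < 28 * t by positivity)]
        exact (abs_apply_le_elen w μ).trans h28.le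
      have hs1 : ∑ μ, (((w μ : ℤ) : ℝ) / (28 * t)) ^ 2 = elen w ^ 2 / (28 * t) ^ 2 := by
        simp only [div_pow]
        rw [← Finset.sum_div, ← hsq]
      have hs2 : ∑ μ, ((w μ : ℤ) : ℝ) / (28 * t) * ((w μ : ℤ) : ℝ) = elen w ^ 2 / (28 * t) := by
        rw [hsq, Finset.sum_div]
        exact Finset.sum_congr rfl fun μ _ => by ring
      have h := abs_freeKer_le_of_shift ht w (fun μ => ((w μ : ℤ) : ℝ) / (28 * t)) hη1
      rw [hs1, hs2] at h
      refine h.trans (htarget _ ?_)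
      have e : 14 * t * (elen w ^ 2 / (28 * t) ^ 2) - elen w ^ 2 / (28 * t) =
          -(elen w ^ 2 / (56 * t)) := by
        field_simp
        ring
      rw [e, neg_le_neg_iff, div_le_div_iff₀ (by linarith) (by positivity)]
      nlinarith [mul_nonneg (sq_nonneg (elen w)) (by linarith : (0 : ℝ) ≤ 1 + elen w)]

/-- Registered headline of this helper file (aux stub of `stub_freeMajorantToolkit`): conjunct (1),
the free Gaussian bound of the free majorant toolkit. -/
theorem stub_freeMajorantToolkitAuxF : ∃ C c : ℝ, 0 < c ∧ ∀ t : ℝ, 0 ≤ t → ∀ w : Site 4, |freeKer t w| ≤ C * gaussProfile c t w :=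
  ⟨_, 1 / 56, by norm_num, fun _t ht w => abs_freeKer_le_gaussProfile ht w⟩

end Summit.QuantumFields.QCD.Cruxes.QuarkLoopCoefficient.Sketch.FreeMajorantToolkit
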